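import Summits.ResolutionOfSingularities.ResolutionOfSingularities.Theorems.DescentHironakaBridgeIEResToPrincipalization
import Summits.ResolutionOfSingularities.ResolutionOfSingularities.Theorems.HironakaBridgeERSGlueRed
import Summits.ResolutionOfSingularities.ResolutionOfSingularities.Theorems.DescentDescentPerfectToAllExhaustion

/-!
# Rung B: the summit decomposes as «resolution over perfect fields» ∧ «resolution over the residual class»,
# and what the typed candidates give WITHOUT the crux stmt-0549 — the master class

Cell `res-hironaka`, LADDER-RESOLUTION rung B (OURS; no statement of any manuscript is asserted: the typed Main
Theorem III `S16Proof.Thm16_14`, the typed §1 claim `HironakaERSPerfect p` / its reduced reading and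
`S01Introduction.MainClaimPerfect` enter ONLY as hypotheses). Companion of `HironakaBridgeCoverage.lean`
(classes (i) essentially of finite type over perfect, (ii) separable algebraic over finitely generated,
(iii) transcendence degree `≤ 1`), using the master class of `DescentDescentPerfectToAllExhaustion.lean`:

* `resolutionOfSingularities_iff_perfectRes_and_residual` — **UNCONDITIONAL DECOMPOSITION OF THE SUMMIT**:
  `ResolutionOfSingularities ↔ (∀ p, PerfectRes p) ∧ (∀ p, resolution over every COUNTABLE field of
  characteristic p that is NOT EFT-separably exhausted)`. The first conjunct is what the manuscript's theorems
  (typed, under adjudication) address; the second is the residual of the crux stmt-0549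
  (`descentPerfectToAll_iff_residual`).
* `hasResolution_of_thm16_14_of_exhaustedByEssFiniteType`,
  `hasResolution_of_hironakaERSPerfect(Reduced)_of_exhaustedByEssFiniteType` — typed candidate (hypothesis) ⇒
  resolution over every EFT-separably exhausted ground field (every finite subset inside a subfield essentially
  of finite type over a perfect field over which the field is Mac Lane-separable), without the crux; this one
  class contains (i), (ii), (iii), the separably exhausted fields and the finite-`p`-basis fields.
* `resolutionOfSingularities_iff_residual_of_thm16_14`, `…_of_mainClaimPerfect` — GIVEN a typed candidate,
  the summit is EQUIVALENT to resolution over the countable non-EFT-separably-exhausted fields of each prime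
  characteristic (the sharpest kernel form of «rung B = the crux»).
-/

noncomputable section

set_option linter.dupNamespace false -- mandated namespace of this single-conjunct summit

open CategoryTheory AlgebraicGeometry
open Literature.AlgebraicGeometry.Resolution
open Literature.AlgebraicGeometry.Hironaka2017.S16Proof

namespace Summit.ResolutionOfSingularities.ResolutionOfSingularities.Theorems

/-! ## The summit = perfect-field resolution ∧ residual-class resolution (unconditional) -/

/-- **Unconditional decomposition of the summit.** `ResolutionOfSingularities` holds iff (a) for every prime
`p` every reduced separated scheme of finite type over every PERFECT field of characteristic `p` has a
resolution (`PerfectRes p`), and (b) for every prime `p` the same holds over every COUNTABLE field of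
characteristic `p` that is NOT EFT-separably exhausted (no system of subfields, essentially of finite type
over perfect fields and with Mac Lane-separable top, exhausts it). (`→`: specialisation; `←`: (b) is the
right-hand side of `descentPerfectToAll_iff_residual`, which gives the crux `DescentPerfectToAll`, and (a)
is its antecedent.) [folklore] -/
theorem resolutionOfSingularities_iff_perfectRes_and_residual :
    _root_.ResolutionOfSingularities ↔
      (∀ p : ℕ, p.Prime → PerfectRes p) ∧
      (∀ p : ℕ, p.Prime → ∀ (k : Type) [Field k] [CharP k p], Countable k →
        (¬ ∀ s : Finset k, ∃ (k₀ : Type) (_ : Field k₀) (_ : PerfectField k₀) (E : Subfield k)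
          (_ : Algebra k₀ E), Algebra.EssFiniteType k₀ E ∧ (↑s : Set k) ⊆ E ∧
            ∀ u : Finset k, LinearIndepOn E _root_.id (↑u : Set k) →
              LinearIndepOn E (fun x : k => x ^ p) (↑u : Set k)) →
        ∀ (X : Scheme.{0}) (f : X ⟶ Spec (.of k)), IsSeparated f → LocallyOfFiniteType f →
          QuasiCompact f → IsReduced X → Scheme.HasResolution X) := by
  constructor
  · intro h
    exact ⟨fun p hp => perfectRes_of_resolutionInChar (_root_.ResolutionOfSingularities_iff.mp h p hp),
      fun p hp k _ _ _ _ X f a b c d => _root_.ResolutionOfSingularities_iff.mp h p hp k X f a b c d⟩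
  · rintro ⟨hP, hR⟩
    have hd : Summit.ResolutionOfSingularities.ResolutionOfSingularities.Theses.Descent.DescentPerfectToAll :=
      descentPerfectToAll_iff_residual.mpr fun p hp _ k _ _ hk hC X f a b c d =>
        hR p hp k hk hC X f a b c d
    exact _root_.ResolutionOfSingularities_iff.mpr fun p hp => hd p hp (hP p hp)

/-! ## From the typed candidates (hypotheses): the master class is reached without the crux -/

/-- Typed Th. 16.14 (hypothesis) ⇒ resolution over every EFT-separably exhausted field of characteristic `p`,
without the crux stmt-0549 (`hasResolution_of_perfectRes_of_exhaustedByEssFiniteType` fed by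
`perfectRes_of_thm16_14`). [folklore] -/
theorem hasResolution_of_thm16_14_of_exhaustedByEssFiniteType (h16 : Thm16_14.{0}) {p : ℕ} [Fact p.Prime]
    (k : Type) [Field k] [CharP k p]
    (hk : ∀ s : Finset k, ∃ (k₀ : Type) (_ : Field k₀) (_ : PerfectField k₀) (E : Subfield k)
      (_ : Algebra k₀ E), Algebra.EssFiniteType k₀ E ∧ (↑s : Set k) ⊆ E ∧
        ∀ u : Finset k, LinearIndepOn E _root_.id (↑u : Set k) →
          LinearIndepOn E (fun x : k => x ^ p) (↑u : Set k))
    (X : Scheme.{0}) (f : X ⟶ Spec (.of k)) [IsSeparated f] [LocallyOfFiniteType f] [QuasiCompact f]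
    [IsReduced X] : Scheme.HasResolution X :=
  hasResolution_of_perfectRes_of_exhaustedByEssFiniteType p
    (fun κ _ _ _ Z h a b c d => perfectRes_of_thm16_14 h16 Fact.out κ Z h a b c d) k hk X f

/-- Typed §1 claim at `p` (hypothesis) ⇒ resolution over every EFT-separably exhausted field of characteristic
`p`, without the crux (`perfectRes_of_hironakaERSPerfect`). [folklore] -/
theorem hasResolution_of_hironakaERSPerfect_of_exhaustedByEssFiniteType {p : ℕ} [Fact p.Prime]
    (hH : HironakaERSPerfect p) (k : Type) [Field k] [CharP k p]
    (hk : ∀ s : Finset k, ∃ (k₀ : Type) (_ : Field k₀) (_ : PerfectField k₀) (E : Subfield k)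
      (_ : Algebra k₀ E), Algebra.EssFiniteType k₀ E ∧ (↑s : Set k) ⊆ E ∧
        ∀ u : Finset k, LinearIndepOn E _root_.id (↑u : Set k) →
          LinearIndepOn E (fun x : k => x ^ p) (↑u : Set k))
    (X : Scheme.{0}) (f : X ⟶ Spec (.of k)) [IsSeparated f] [LocallyOfFiniteType f] [QuasiCompact f]
    [IsReduced X] : Scheme.HasResolution X :=
  hasResolution_of_perfectRes_of_exhaustedByEssFiniteType p
    (fun κ _ _ _ Z h a b c d => perfectRes_of_hironakaERSPerfect hH κ Z h a b c d) k hk X f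

/-- Typed §1 claim at `p` in the REDUCED reading (hypothesis) ⇒ resolution over every EFT-separably exhausted
field of characteristic `p`, without the crux (`perfectRes_of_hironakaERSPerfectReduced`). [folklore] -/
theorem hasResolution_of_hironakaERSPerfectReduced_of_exhaustedByEssFiniteType {p : ℕ} [Fact p.Prime]
    (hH : HironakaERSPerfectReduced p) (k : Type) [Field k] [CharP k p]
    (hk : ∀ s : Finset k, ∃ (k₀ : Type) (_ : Field k₀) (_ : PerfectField k₀) (E : Subfield k)
      (_ : Algebra k₀ E), Algebra.EssFiniteType k₀ E ∧ (↑s : Set k) ⊆ E ∧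
        ∀ u : Finset k, LinearIndepOn E _root_.id (↑u : Set k) →
          LinearIndepOn E (fun x : k => x ^ p) (↑u : Set k))
    (X : Scheme.{0}) (f : X ⟶ Spec (.of k)) [IsSeparated f] [LocallyOfFiniteType f] [QuasiCompact f]
    [IsReduced X] : Scheme.HasResolution X :=
  hasResolution_of_perfectRes_of_exhaustedByEssFiniteType p
    (fun κ _ _ _ Z h a b c d => perfectRes_of_hironakaERSPerfectReduced hH κ Z h a b c d) k hk X f

/-! ## Given a typed candidate, the summit is equivalent to resolution over the residual class -/

/-- GIVEN typed Th. 16.14 (hypothesis), the summit `ResolutionOfSingularities` is EQUIVALENT to: for every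
prime `p`, every reduced separated scheme of finite type over every COUNTABLE, NOT EFT-separably exhausted
field of characteristic `p` has a resolution. [folklore] -/
theorem resolutionOfSingularities_iff_residual_of_thm16_14 (h16 : Thm16_14.{0}) :
    _root_.ResolutionOfSingularities ↔
      ∀ p : ℕ, p.Prime → ∀ (k : Type) [Field k] [CharP k p], Countable k →
        (¬ ∀ s : Finset k, ∃ (k₀ : Type) (_ : Field k₀) (_ : PerfectField k₀) (E : Subfield k)
          (_ : Algebra k₀ E), Algebra.EssFiniteType k₀ E ∧ (↑s : Set k) ⊆ E ∧
            ∀ u : Finset k, LinearIndepOn E _root_.id (↑u : Set k) →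
              LinearIndepOn E (fun x : k => x ^ p) (↑u : Set k)) →
        ∀ (X : Scheme.{0}) (f : X ⟶ Spec (.of k)), IsSeparated f → LocallyOfFiniteType f →
          QuasiCompact f → IsReduced X → Scheme.HasResolution X :=
  ⟨fun h => (resolutionOfSingularities_iff_perfectRes_and_residual.mp h).2, fun hR =>
    resolutionOfSingularities_iff_perfectRes_and_residual.mpr
      ⟨fun _ hp => perfectRes_of_thm16_14 h16 hp, hR⟩⟩

/-- GIVEN the typed §1 claim over perfect fields for all primes (`S01Introduction.MainClaimPerfect`, a
hypothesis), the summit `ResolutionOfSingularities` is EQUIVALENT to resolution over the countable,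
NOT EFT-separably exhausted fields of each prime characteristic. [folklore] -/
theorem resolutionOfSingularities_iff_residual_of_mainClaimPerfect
    (hH : Literature.AlgebraicGeometry.Hironaka2017.S01Introduction.MainClaimPerfect.{0}) :
    _root_.ResolutionOfSingularities ↔
      ∀ p : ℕ, p.Prime → ∀ (k : Type) [Field k] [CharP k p], Countable k →
        (¬ ∀ s : Finset k, ∃ (k₀ : Type) (_ : Field k₀) (_ : PerfectField k₀) (E : Subfield k)
          (_ : Algebra k₀ E), Algebra.EssFiniteType k₀ E ∧ (↑s : Set k) ⊆ E ∧
            ∀ u : Finset k, LinearIndepOn E _root_.id (↑u : Set k) →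
              LinearIndepOn E (fun x : k => x ^ p) (↑u : Set k)) →
        ∀ (X : Scheme.{0}) (f : X ⟶ Spec (.of k)), IsSeparated f → LocallyOfFiniteType f →
          QuasiCompact f → IsReduced X → Scheme.HasResolution X :=
  ⟨fun h => (resolutionOfSingularities_iff_perfectRes_and_residual.mp h).2, fun hR =>
    resolutionOfSingularities_iff_perfectRes_and_residual.mpr
      ⟨fun p hp => perfectRes_of_hironakaERSPerfect (mainClaimPerfect_iff.mp hH p hp), hR⟩⟩

end Summit.ResolutionOfSingularities.ResolutionOfSingularities.Theorems

end
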